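import Mathlib
import HarnessLib
import Literature.Analysis.FluidPDE.VectorCalculus
import Literature.Analysis.FluidPDE.VorticityCalculus
import Literature.Analysis.FluidPDE.NSBoundedMildOseen
import Literature.Analysis.UnboundedOperators.HeatKernelBoundedData
import Summits.NavierStokesRegularity.NavierStokesRegularity.Theorems.UnthreadedRigidityDoorUnthreadedRigidityVirialHornAnalyticWedge

/-!
# Route `UnthreadedRigidityDoor`, wall item W2 `UnthreadedRigidity` (stmt-NavierStokesRegularity-27585) — LINE g12-2 «PERSISTENCE FILTER»
# (ns-idea-6 g12, `Persistence_sketch.lean` 09bc8f71301208c4): the bridge M `WindowVorticityBalance` AS STATED is false — a degenerate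
# counterexample (`Y ≡ 0`, `u ≡ 0`, a non-analytic admissible profile), and the one-hypothesis repair

Seat ns-es-p1 g8 (W2 second queue; announce-before-propose on the ideators bus).

* `not_windowVorticityBalance` — **`¬ WindowVorticityBalance` (the sketch's Prop VERBATIM, its local `IsToroidallyBalanced` / `lambCurl` /
  `torShell` unfolded)**.  WITNESS: `S = univ`, `u ≡ 0` (a bounded mild window: `e^{tΔ}0 = 0`, `B(0,0) = 0`), `x₀ = 0`, `l = 1`, `Y ≡ 0` (a solid
  harmonic of every degree, `…VirialHorn.isSolidHarmonic_zero`), `Hf t = H`, `H(r) = φ(r²)` with `φ` a smooth bump (`= 1` on `[−1/8,1/8]`, `= 0` off `(−1/4,1/4)`): `H` is virial-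
  admissible (it vanishes on `(1/2,∞)`), `u t = sepShellL H 0 0 = 0`, but `H` is NOT real-analytic on `(0,∞)` (`H(1/4) = 1`, `H ≡ 0` near `1`,
  identity theorem).  The second conjunct of the conclusion fails.
* CLASS: MISSTATED (degenerate case).  REPAIR `C′`: add the hypothesis `(∃ y, Y y ≠ 0)` (present in every downstream use: `BalanceBookkeeping`,
  `SingleShellNonPersistence`); the witness misses `C′`.  The first conjunct (toroidal balance) is untouched by the witness.

HONEST LABEL: a statement-hygiene fact about a files-only rung line; nothing here bears on `UnthreadedRigidity` (27585), the door Target, W2 or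
Navier–Stokes regularity; no summit statement is proved or refuted.  0 kit.
-/

noncomputable section

-- the summit and its single sub-problem share the name (CONVENTIONS §1), as in every Theorems file
set_option linter.dupNamespace false

namespace Summit.NavierStokesRegularity.NavierStokesRegularity.Theorems.UnthreadedRigidity.Persistence

open Set Function Filter Topology
open Literature.Analysis.FluidPDE (curl cross oseenDuhamel)
open Literature.Analysis.UnboundedOperators (heatExtension)
open Summit.NavierStokesRegularity.NavierStokesRegularity.Theorems.UnthreadedRigidity.ProfileHorn (E3)
open Summit.NavierStokesRegularity.NavierStokesRegularity.Theorems.UnthreadedRigidity.VirialHorn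
  (IsSolidHarmonic VirialAdmissible sepShellL isSolidHarmonic_zero)

/-! ## The zero field and the zero harmonic -/

/-- The separable shell over `Y ≡ 0` is the zero field. -/
theorem sepShellL_zero (H : ℝ → ℝ) (x₀ : E3) : sepShellL H (fun _ : E3 => (0 : ℝ)) x₀ = fun _ => 0 := by
  unfold sepShellL
  have h : (fun x : E3 => (H ‖x - x₀‖ * (fun _ : E3 => (0 : ℝ)) (x - x₀)) • (x - x₀)) = fun _ => (0 : E3) := by
    funext x; simp
  have h0 : curl (fun _ : E3 => (0 : E3)) = fun _ => 0 := funext Literature.Analysis.FluidPDE.curl_fun_zero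
  rw [h, h0, h0]

/-! ## A non-analytic admissible profile -/

/-- A smooth compactly supported even profile is virial-admissible but not real-analytic on `(0,∞)`. -/
theorem exists_admissible_not_analytic (l : ℕ) :
    ∃ H : ℝ → ℝ, VirialAdmissible l H ∧ ¬ AnalyticOnNhd ℝ H (Ioi 0) := by
  let φ : ContDiffBump (0 : ℝ) := ⟨1 / 8, 1 / 4, by norm_num, by norm_num⟩
  refine ⟨fun r => φ (r ^ 2), ⟨⟨φ, φ.contDiff, fun r _ => rfl⟩, ?_⟩, ?_⟩
  · -- the profile vanishes on `(1/2, ∞)`, so every decay bound holds with `C = 0`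
    have hzero : ∀ r : ℝ, 1 / 2 < r → (fun r : ℝ => φ (r ^ 2)) r = 0 := by
      intro r hr
      apply φ.zero_of_le_dist
      rw [Real.dist_eq, sub_zero, abs_of_nonneg (by positivity)]
      show (1 : ℝ) / 4 ≤ r ^ 2
      nlinarith
    have hev : ∀ r : ℝ, 1 / 2 < r → (fun r : ℝ => φ (r ^ 2)) =ᶠ[𝓝 r] fun _ => (0 : ℝ) := fun r hr => by
      filter_upwards [Ioi_mem_nhds hr] with s hs
      exact hzero s hs
    have hd1 : ∀ r : ℝ, 1 / 2 < r → deriv (fun r : ℝ => φ (r ^ 2)) r = 0 := fun r hr => by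
      rw [(hev r hr).deriv_eq]; simp
    have hd2 : ∀ r : ℝ, 1 / 2 < r → deriv (deriv (fun r : ℝ => φ (r ^ 2))) r = 0 := fun r hr => by
      have h1 : deriv (fun r : ℝ => φ (r ^ 2)) =ᶠ[𝓝 r] fun _ => (0 : ℝ) := by
        filter_upwards [Ioi_mem_nhds hr] with s hs
        exact hd1 s hs
      rw [h1.deriv_eq]; simp
    refine ⟨0, fun r hr => ?_⟩
    have hr' : (1 : ℝ) / 2 < r := by linarith
    rw [hzero r hr', hd1 r hr', hd2 r hr']
    simp
  · -- not analytic: `H(1/4) = 1` but `H ≡ 0` near `1`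
    intro hA
    have hone : φ (((1 : ℝ) / 4) ^ 2) = 1 := by
      apply φ.one_of_mem_closedBall
      rw [Metric.mem_closedBall, Real.dist_eq, sub_zero]
      norm_num
    have hev : (fun r : ℝ => φ (r ^ 2)) =ᶠ[𝓝 (1 : ℝ)] 0 := by
      filter_upwards [Ioi_mem_nhds (show (1 : ℝ) / 2 < 1 by norm_num)] with s hs
      have hs' : (1 : ℝ) / 2 < s := hs
      show φ (s ^ 2) = 0
      apply φ.zero_of_le_dist
      rw [Real.dist_eq, sub_zero, abs_of_nonneg (by positivity)]
      show (1 : ℝ) / 4 ≤ s ^ 2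
      nlinarith
    have hz := hA.eqOn_zero_of_preconnected_of_eventuallyEq_zero (convex_Ioi (0 : ℝ)).isPreconnected
      (show (1 : ℝ) ∈ Ioi 0 by norm_num) hev
    have h14 := hz (show (1 : ℝ) / 4 ∈ Ioi 0 by norm_num)
    simp only [Pi.zero_apply] at h14
    rw [hone] at h14
    exact one_ne_zero h14

/-! ## The refutation -/

/-- **`¬ WindowVorticityBalance`** (the sketch's bridge M VERBATIM, with `IsToroidallyBalanced`, `lambCurl`, `torShell` unfolded): witness
`S = univ`, `u ≡ 0`, `x₀ = 0`, `l = 1`, `Y ≡ 0`, `Hf t =` a smooth compactly supported even profile (module docstring).  CLASS misstated; REPAIR: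
add `(∃ y, Y y ≠ 0)`. -/
theorem not_windowVorticityBalance :
    ¬ (∀ (S : Set ℝ), IsOpen S → ∀ (u : ℝ → E3 → E3) (x₀ : E3),
        ContinuousOn (Function.uncurry u) (S ×ˢ Set.univ) →
        (∀ t ∈ S, Literature.Analysis.FluidPDE.VectorCalculus.IsDivFree (u t)) →
        (∀ s ∈ S, ∀ t ∈ S, s < t → ∀ x, u t x =
            Literature.Analysis.UnboundedOperators.heatExtension (u s) (t - s) x
              - Literature.Analysis.FluidPDE.oseenDuhamel 1 s u u t x) →
        (∀ τ ∈ S, ∃ B : ℝ, ∀ t ∈ S, t ≤ τ → ∀ x, ‖u t x‖ ≤ B) →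
        ∀ (l : ℕ) (Y : E3 → ℝ) (Hf : ℝ → ℝ → ℝ), 1 ≤ l → IsSolidHarmonic l Y →
          (∀ t ∈ S, VirialAdmissible l (Hf t)) → (∀ t ∈ S, u t = sepShellL (Hf t) Y x₀) →
          ∀ t ∈ S, (∃ e : ℝ → ℝ, ∀ y : E3, y ≠ 0 →
              curl (fun x => cross (curl (u t) x) (u t x)) (x₀ + y)
                = e ‖x₀ + y - x₀‖ • cross (gradient Y (x₀ + y - x₀)) (x₀ + y - x₀)) ∧
            AnalyticOnNhd ℝ (Hf t) (Set.Ioi 0)) := by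
  intro h
  obtain ⟨H, hH, hHna⟩ := exists_admissible_not_analytic 1
  have hmild : ∀ s ∈ (univ : Set ℝ), ∀ t ∈ (univ : Set ℝ), s < t → ∀ x : E3, (fun (_ : ℝ) (_ : E3) => (0 : E3)) t x =
      heatExtension ((fun (_ : ℝ) (_ : E3) => (0 : E3)) s) (t - s) x
        - oseenDuhamel 1 s (fun (_ : ℝ) (_ : E3) => (0 : E3)) (fun (_ : ℝ) (_ : E3) => (0 : E3)) t x := by
    intro s _ t _ hst x
    rw [Literature.Analysis.UnboundedOperators.heatExtension_const (0 : E3) (sub_pos.2 hst)]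
    simp [oseenDuhamel]
  have hdiv : ∀ t ∈ (univ : Set ℝ), Literature.Analysis.FluidPDE.VectorCalculus.IsDivFree ((fun (_ : ℝ) (_ : E3) => (0 : E3)) t) := by
    intro t _ x
    simp [Literature.Analysis.FluidPDE.VectorCalculus.divergence]
  have hres := h univ isOpen_univ (fun _ _ => 0) 0 continuousOn_const hdiv hmild
    (fun τ _ => ⟨0, fun t _ _ x => by simp⟩) 1 (fun _ => 0) (fun _ => H) le_rfl (isSolidHarmonic_zero 1)
    (fun t _ => hH) (fun t _ => by rw [sepShellL_zero]) 0 (mem_univ _)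
  exact hHna hres.2

end Summit.NavierStokesRegularity.NavierStokesRegularity.Theorems.UnthreadedRigidity.Persistence

end
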